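import Summits.AtomisticToContinuum.HydrodynamicLimit.Theorems.EnskogAdjointDualityEquilibriumCollisionResidualKernelSymmetry
import HarnessLib

/-!
# K2R corrector balance I: kinematics and the pointwise bracket estimate

Route `EnskogAdjointDuality` of `AtomisticToContinuum/HydrodynamicLimit`, crux `AdjointEnskogTestFamilyR`
(stmt-AtomisticToContinuum-11592, "K2R"), line `birth`, stub `stub_correctorBalance` (B4): the corrector `κ` of
the test family `φ^N = ψ^N + κ^N/λ_N` pairs to `O(ε)` with the test-side Enskog operator against the Euler
local Maxwellian `f = ρ₀ M_{1,θ₀,u₀}` (local detailed balance: the `λ_N` of the operator cancels the `1/λ_N`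
of the corrector, and the equal-position bracket integrates to zero).
This file holds the measure-free kinematics:

* `k2r_dist_translate_le`, `k2r_dist_translate_smul_le` — the contact shift `x ↦ x + εω` moves a point
  of `𝕋³` by at most `ε`;
* `k2r_abs_hardSphereKernel_sub_le`, `k2r_norm_collide_fst_sub_le`, `k2r_norm_collide_snd_sub_le` — the
  hard-sphere kernel `((v−w)·ω)₊` and the post-collisional velocities `v′, w′` are Lipschitz in the partner
  velocity `w` (for fixed `v`, `ω`);
* `k2r_bracket_pointwise` — the collision bracket `((v−a)·ω)₊ [κ₁(v′) + κ₂(a′) − κ₁(v) − κ₂(a)]` with two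
  velocity functions of quadratic growth (`κ₁` weighted-Lipschitz, `|κ₁ − κ₂| ≤ C(1+2|·|²) d`) differs from
  the one-function bracket at partner velocity `b` by `≤ 16 C ((1+|v|²)(1+|a|²)(1+|b|²))² (d + |a − b|)`;
* `k2r_abs_bracket_le` — the bracket has growth `4 C ((1+|v|²)(1+|w|²))²`;
* `stub_correctorBalance_pointwise` — the registered sub-goal (closed form of `k2r_bracket_pointwise`).

References: C. Cercignani, R. Illner, M. Pulvirenti, *The Mathematical Theory of Dilute Gases* (1994), §3.1
(collision kinematics, detailed balance) [CIP1994].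
-/

noncomputable section

open MeasureTheory ProbabilityTheory Metric Set Filter Topology Function
open scoped InnerProductSpace ENNReal

namespace Summit.AtomisticToContinuum.HydrodynamicLimit.Theorems.EnskogAdjointDuality

open Literature.Analysis.FluidPDE Literature.MathematicalPhysics.KineticTheory

/-! ## The contact shift on `𝕋³` -/

/-- The contact shift moves a point of the torus by at most the length of the shift vector:
`dist (x + proj a) x ≤ ‖a‖` (the torus metric is the sup of the quotient norms of the three
`UnitAddCircle` coordinates, each `≤ |a i| ≤ ‖a‖`). [folklore] -/
theorem k2r_dist_translate_le (x : T3) (a : V3) :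
    dist ((Torus.geometry (Fin 3)).translate x a) x ≤ ‖a‖ := by
  rw [Torus.geometry_translate, dist_eq_norm, add_sub_cancel_left,
    pi_norm_le_iff_of_nonneg (norm_nonneg _)]
  intro i
  have h := QuotientAddGroup.norm_mk_le_norm (S := AddSubgroup.zmultiples (1 : ℝ)) (m := a i)
  have hi : |a i| ≤ ‖a‖ := by simpa using PiLp.norm_apply_le a i
  exact (by simpa using h : ‖((a i : ℝ) : UnitAddCircle)‖ ≤ ‖a i‖).trans
    (by simpa [Real.norm_eq_abs] using hi)

/-- For a unit vector `ω` and `ε ≥ 0`, the contact partner `x + εω` is within `ε` of `x`. [folklore] -/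
theorem k2r_dist_translate_smul_le (x : T3) (ω : sphere (0 : V3) 1) {ε : ℝ} (hε : 0 ≤ ε) :
    dist x ((Torus.geometry (Fin 3)).translate x (ε • (ω : V3))) ≤ ε := by
  rw [dist_comm]
  refine (k2r_dist_translate_le x _).trans ?_
  rw [norm_smul, norm_eq_of_mem_sphere ω, mul_one, Real.norm_eq_abs, abs_of_nonneg hε]

/-! ## Kinematics in the partner velocity -/

/-- `|⟪c, ω⟫| ≤ ‖c‖` for a unit vector `ω`. [folklore] -/
theorem k2r_abs_inner_sphere_le (ω : sphere (0 : V3) 1) (c : V3) : |⟪c, (ω : V3)⟫_ℝ| ≤ ‖c‖ := by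
  calc |⟪c, (ω : V3)⟫_ℝ| ≤ ‖c‖ * ‖(ω : V3)‖ := abs_real_inner_le_norm _ _
    _ = ‖c‖ := by rw [norm_eq_of_mem_sphere ω, mul_one]

/-- The hard-sphere kernel is `1`-Lipschitz in the partner velocity:
`|((v−a)·ω)₊ − ((v−b)·ω)₊| ≤ ‖a − b‖`. [folklore] -/
theorem k2r_abs_hardSphereKernel_sub_le (ω : sphere (0 : V3) 1) (v a b : V3) :
    |hardSphereKernel (v, a) ω - hardSphereKernel (v, b) ω| ≤ ‖a - b‖ := by
  unfold hardSphereKernel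
  refine (abs_max_sub_max_le_abs _ _ _).trans ?_
  have h : ⟪v - a, (ω : V3)⟫_ℝ - ⟪v - b, (ω : V3)⟫_ℝ = ⟪b - a, (ω : V3)⟫_ℝ := by
    rw [← inner_sub_left]
    congr 1
    abel
  rw [h, norm_sub_rev]
  exact k2r_abs_inner_sphere_le ω _

/-- `((v−w)·ω)₊ ≤ ‖v − w‖`. [folklore] -/
theorem k2r_hardSphereKernel_le_norm_sub (ω : sphere (0 : V3) 1) (v w : V3) :
    hardSphereKernel (v, w) ω ≤ ‖v - w‖ := by
  unfold hardSphereKernel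
  exact max_le ((le_abs_self _).trans (k2r_abs_inner_sphere_le ω _)) (norm_nonneg _)

/-- `((v−w)·ω)₊ ≤ (1 + |v|²)(1 + |w|²)`. [folklore] -/
theorem k2r_hardSphereKernel_le_sq (ω : sphere (0 : V3) 1) (v w : V3) :
    hardSphereKernel (v, w) ω ≤ (1 + ‖v‖ ^ 2) * (1 + ‖w‖ ^ 2) := by
  have h1 := k2r_hardSphereKernel_le_norm_sub ω v w
  have h2 : ‖v - w‖ ≤ ‖v‖ + ‖w‖ := norm_sub_le v w
  nlinarith [sq_nonneg (‖v‖ - 1), sq_nonneg (‖w‖ - 1), norm_nonneg v, norm_nonneg w,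
    mul_nonneg (sq_nonneg ‖v‖) (sq_nonneg ‖w‖)]

/-- `v′(a) − v′(b) = ⟪a − b, ω⟫ ω` for the first post-collisional velocity as a function of the partner.
[folklore] -/
theorem k2r_collide_fst_sub (ω : sphere (0 : V3) 1) (v a b : V3) :
    (collide ω (v, a)).1 - (collide ω (v, b)).1 = ⟪a - b, (ω : V3)⟫_ℝ • (ω : V3) := by
  have h : ⟪a - b, (ω : V3)⟫_ℝ = ⟪v - b, (ω : V3)⟫_ℝ - ⟪v - a, (ω : V3)⟫_ℝ := by
    rw [← inner_sub_left]
    congr 1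
    abel
  simp only [collide, h, sub_smul]
  abel

/-- `w′(a) − w′(b) = (a − b) − ⟪a − b, ω⟫ ω` for the second post-collisional velocity. [folklore] -/
theorem k2r_collide_snd_sub (ω : sphere (0 : V3) 1) (v a b : V3) :
    (collide ω (v, a)).2 - (collide ω (v, b)).2 = (a - b) - ⟪a - b, (ω : V3)⟫_ℝ • (ω : V3) := by
  have h : ⟪a - b, (ω : V3)⟫_ℝ = ⟪v - b, (ω : V3)⟫_ℝ - ⟪v - a, (ω : V3)⟫_ℝ := by
    rw [← inner_sub_left]
    congr 1
    abel
  simp only [collide, h, sub_smul]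
  abel

/-- `‖v′(a) − v′(b)‖ ≤ ‖a − b‖`. [folklore] -/
theorem k2r_norm_collide_fst_sub_le (ω : sphere (0 : V3) 1) (v a b : V3) :
    ‖(collide ω (v, a)).1 - (collide ω (v, b)).1‖ ≤ ‖a - b‖ := by
  rw [k2r_collide_fst_sub, norm_smul, norm_eq_of_mem_sphere ω, mul_one, Real.norm_eq_abs]
  exact k2r_abs_inner_sphere_le ω _

/-- `‖w′(a) − w′(b)‖ ≤ 2 ‖a − b‖`. [folklore] -/
theorem k2r_norm_collide_snd_sub_le (ω : sphere (0 : V3) 1) (v a b : V3) :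
    ‖(collide ω (v, a)).2 - (collide ω (v, b)).2‖ ≤ 2 * ‖a - b‖ := by
  rw [k2r_collide_snd_sub]
  calc ‖(a - b) - ⟪a - b, (ω : V3)⟫_ℝ • (ω : V3)‖
      ≤ ‖a - b‖ + ‖⟪a - b, (ω : V3)⟫_ℝ • (ω : V3)‖ := norm_sub_le _ _
    _ ≤ ‖a - b‖ + ‖a - b‖ := by
        gcongr
        rw [norm_smul, norm_eq_of_mem_sphere ω, mul_one, Real.norm_eq_abs]
        exact k2r_abs_inner_sphere_le ω _
    _ = 2 * ‖a - b‖ := by ring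

/-! ## The pointwise bracket estimate -/

/-- `1 + s ≤ (1 + p)(1 + q)` when `s ≤ p + q`, `p, q ≥ 0`. [folklore] -/
theorem k2r_weight_aux₁ {p q s : ℝ} (hp : 0 ≤ p) (hq : 0 ≤ q) (hs : s ≤ p + q) :
    1 + s ≤ (1 + p) * (1 + q) := by
  nlinarith [mul_nonneg hp hq]

/-- `1 + 2s ≤ 2 (1 + p)(1 + q)` when `s ≤ p + q`, `p, q ≥ 0`. [folklore] -/
theorem k2r_weight_aux₂ {p q s : ℝ} (hp : 0 ≤ p) (hq : 0 ≤ q) (hs : s ≤ p + q) :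
    1 + s + s ≤ 2 * ((1 + p) * (1 + q)) := by
  nlinarith [mul_nonneg hp hq]

/-- `1 + 2p + q + r ≤ 2 (1 + p)(1 + q)(1 + r)` for `p, q, r ≥ 0`. [folklore] -/
theorem k2r_weight_aux₃ {p q r : ℝ} (hp : 0 ≤ p) (hq : 0 ≤ q) (hr : 0 ≤ r) :
    1 + 2 * p + q + r ≤ 2 * ((1 + p) * (1 + q) * (1 + r)) := by
  nlinarith [mul_nonneg hp hq, mul_nonneg hp hr, mul_nonneg hq hr, mul_nonneg (mul_nonneg hp hq) hr]

/-- **Pointwise bracket estimate.** For a fixed impact direction `ω`, velocity functions `κ₁, κ₂` with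
`|κ₁| ≤ C(1+|·|²)`, `κ₁` weighted-Lipschitz `|κ₁(v) − κ₁(v′)| ≤ C(1+|v|²+|v′|²)|v − v′|` and
`|κ₁ − κ₂| ≤ C(1 + 2|·|²) d` (`d ≥ 0`), the two-function collision bracket at partner velocity `a`,
`((v−a)·ω)₊ [κ₁(v′) + κ₂(a′) − κ₁(v) − κ₂(a)]`, differs from the one-function bracket at partner velocity `b`,
`((v−b)·ω)₊ [κ₁(v′) + κ₁(b′) − κ₁(v) − κ₁(b)]`, by at most
`16 C ((1+|v|²)(1+|a|²)(1+|b|²))² (d + |a − b|)`. [folklore] -/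
theorem k2r_bracket_pointwise (ω : sphere (0 : V3) 1) {κ₁ κ₂ : V3 → ℝ} {C d : ℝ} (hd : 0 ≤ d)
    (hκ₁ : ∀ v, |κ₁ v| ≤ C * (1 + ‖v‖ ^ 2))
    (hκ₁L : ∀ v v', |κ₁ v - κ₁ v'| ≤ C * (1 + ‖v‖ ^ 2 + ‖v'‖ ^ 2) * ‖v - v'‖)
    (hκ₁₂ : ∀ v, |κ₁ v - κ₂ v| ≤ C * (1 + ‖v‖ ^ 2 + ‖v‖ ^ 2) * d) (v a b : V3) :
    |hardSphereKernel (v, a) ω * (κ₁ (collide ω (v, a)).1 + κ₂ (collide ω (v, a)).2 - κ₁ v - κ₂ a) -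
      hardSphereKernel (v, b) ω * (κ₁ (collide ω (v, b)).1 + κ₁ (collide ω (v, b)).2 - κ₁ v - κ₁ b)| ≤
      16 * C * ((1 + ‖v‖ ^ 2) * (1 + ‖a‖ ^ 2) * (1 + ‖b‖ ^ 2)) ^ 2 * (d + ‖a - b‖) := by
  have hC : 0 ≤ C := by
    have h := (abs_nonneg _).trans (hκ₁ 0)
    simpa using h
  -- the kernel and the post-collisional velocities at the two partner velocities
  set ka : ℝ := hardSphereKernel (v, a) ω with hka
  set kb : ℝ := hardSphereKernel (v, b) ω with hkb
  set va : V3 := (collide ω (v, a)).1 with hva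
  set a' : V3 := (collide ω (v, a)).2 with ha'
  set vb : V3 := (collide ω (v, b)).1 with hvb
  set b' : V3 := (collide ω (v, b)).2 with hb'
  set X : ℝ := 1 + ‖v‖ ^ 2 with hX
  set Y : ℝ := 1 + ‖a‖ ^ 2 with hY
  set Z : ℝ := 1 + ‖b‖ ^ 2 with hZ
  -- facts that use the definitions of the abbreviations
  have hka0 : 0 ≤ ka := UkaiLanford.hardSphereKernel_nonneg' (v, a) ω
  have hkb0 : 0 ≤ kb := UkaiLanford.hardSphereKernel_nonneg' (v, b) ω
  have hkaXY : ka ≤ X * Y := k2r_hardSphereKernel_le_sq ω v a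
  have hkbXZ : kb ≤ X * Z := k2r_hardSphereKernel_le_sq ω v b
  have hkab : |ka - kb| ≤ ‖a - b‖ := k2r_abs_hardSphereKernel_sub_le ω v a b
  have hva2 : ‖va‖ ^ 2 ≤ ‖v‖ ^ 2 + ‖a‖ ^ 2 := (norm_sq_collide_le ω (v, a)).1
  have ha2 : ‖a'‖ ^ 2 ≤ ‖v‖ ^ 2 + ‖a‖ ^ 2 := (norm_sq_collide_le ω (v, a)).2
  have hvb2 : ‖vb‖ ^ 2 ≤ ‖v‖ ^ 2 + ‖b‖ ^ 2 := (norm_sq_collide_le ω (v, b)).1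
  have hb2 : ‖b'‖ ^ 2 ≤ ‖v‖ ^ 2 + ‖b‖ ^ 2 := (norm_sq_collide_le ω (v, b)).2
  have hvab : ‖va - vb‖ ≤ ‖a - b‖ := k2r_norm_collide_fst_sub_le ω v a b
  have ha'b' : ‖a' - b'‖ ≤ 2 * ‖a - b‖ := k2r_norm_collide_snd_sub_le ω v a b
  have g3' : |κ₁ v| ≤ C * X := hκ₁ v
  have g4' : |κ₁ a| ≤ C * Y := hκ₁ a
  clear_value ka kb va a' vb b' X Y Z
  have hp : 0 ≤ ‖v‖ ^ 2 := sq_nonneg _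
  have hq : 0 ≤ ‖a‖ ^ 2 := sq_nonneg _
  have hr : 0 ≤ ‖b‖ ^ 2 := sq_nonneg _
  have hX1 : 1 ≤ X := by rw [hX]; linarith
  have hY1 : 1 ≤ Y := by rw [hY]; linarith
  have hZ1 : 1 ≤ Z := by rw [hZ]; linarith
  have hX0 : 0 ≤ X := zero_le_one.trans hX1
  have hZ0 : 0 ≤ Z := zero_le_one.trans hZ1
  have hXY1 : 1 ≤ X * Y := one_le_mul_of_one_le_of_one_le hX1 hY1
  have hXY0 : 0 ≤ X * Y := zero_le_one.trans hXY1
  have hXZ0 : 0 ≤ X * Z := mul_nonneg hX0 hZ0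
  have hXYZ1 : 1 ≤ X * Y * Z := one_le_mul_of_one_le_of_one_le hXY1 hZ1
  have hXYZ0 : 0 ≤ X * Y * Z := zero_le_one.trans hXYZ1
  -- polynomial weights
  have w1 : 1 + ‖va‖ ^ 2 ≤ X * Y := by rw [hX, hY]; exact k2r_weight_aux₁ hp hq hva2
  have w2 : 1 + ‖a'‖ ^ 2 ≤ X * Y := by rw [hX, hY]; exact k2r_weight_aux₁ hp hq ha2
  have w3 : X ≤ X * Y := le_mul_of_one_le_right hX0 hY1
  have w4 : Y ≤ X * Y := le_mul_of_one_le_left (zero_le_one.trans hY1) hX1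
  have w5 : 1 + ‖a'‖ ^ 2 + ‖a'‖ ^ 2 ≤ 2 * (X * Y) := by rw [hX, hY]; exact k2r_weight_aux₂ hp hq ha2
  have w6 : 1 + ‖a‖ ^ 2 + ‖a‖ ^ 2 ≤ 2 * (X * Y) := by
    rw [hX, hY]; exact k2r_weight_aux₂ hp hq (by linarith)
  have hXYZ : 1 + 2 * ‖v‖ ^ 2 + ‖a‖ ^ 2 + ‖b‖ ^ 2 ≤ 2 * (X * Y * Z) := by
    rw [hX, hY, hZ]; exact k2r_weight_aux₃ hp hq hr
  have w7 : 1 + ‖va‖ ^ 2 + ‖vb‖ ^ 2 ≤ 2 * (X * Y * Z) := by linarith only [hXYZ, hva2, hvb2]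
  have w8 : 1 + ‖a'‖ ^ 2 + ‖b'‖ ^ 2 ≤ 2 * (X * Y * Z) := by linarith only [hXYZ, ha2, hb2]
  have w9 : 1 + ‖a‖ ^ 2 + ‖b‖ ^ 2 ≤ 2 * (X * Y * Z) := by linarith only [hXYZ, hp]
  -- growth of `κ₁` at the four velocities of the `a`-collision
  have g1 : |κ₁ va| ≤ C * (X * Y) := (hκ₁ va).trans (mul_le_mul_of_nonneg_left w1 hC)
  have g2 : |κ₁ a'| ≤ C * (X * Y) := (hκ₁ a').trans (mul_le_mul_of_nonneg_left w2 hC)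
  have g3 : |κ₁ v| ≤ C * (X * Y) := g3'.trans (mul_le_mul_of_nonneg_left w3 hC)
  have g4 : |κ₁ a| ≤ C * (X * Y) := g4'.trans (mul_le_mul_of_nonneg_left w4 hC)
  have hBr0a : |κ₁ va + κ₁ a' - κ₁ v - κ₁ a| ≤ 4 * C * (X * Y) := by
    have e1 := abs_sub (κ₁ va + κ₁ a' - κ₁ v) (κ₁ a)
    have e2 := abs_sub (κ₁ va + κ₁ a') (κ₁ v)
    have e3 := abs_add_le (κ₁ va) (κ₁ a')
    linarith only [e1, e2, e3, g1, g2, g3, g4]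
  -- replacing `κ₂` by `κ₁` at the partner costs `4 C X Y d`
  have hT1 : |(κ₁ va + κ₂ a' - κ₁ v - κ₂ a) - (κ₁ va + κ₁ a' - κ₁ v - κ₁ a)| ≤ 4 * C * (X * Y) * d := by
    have e : (κ₁ va + κ₂ a' - κ₁ v - κ₂ a) - (κ₁ va + κ₁ a' - κ₁ v - κ₁ a) =
        (κ₁ a - κ₂ a) - (κ₁ a' - κ₂ a') := by ring
    rw [e]
    have f1 : |κ₁ a' - κ₂ a'| ≤ C * (2 * (X * Y)) * d :=
      (hκ₁₂ a').trans (mul_le_mul_of_nonneg_right (mul_le_mul_of_nonneg_left w5 hC) hd)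
    have f2 : |κ₁ a - κ₂ a| ≤ C * (2 * (X * Y)) * d :=
      (hκ₁₂ a).trans (mul_le_mul_of_nonneg_right (mul_le_mul_of_nonneg_left w6 hC) hd)
    have e2 := abs_sub (κ₁ a - κ₂ a) (κ₁ a' - κ₂ a')
    linarith only [e2, f1, f2]
  -- moving the partner from `a` to `b` in the one-function bracket costs `8 C X Y Z ‖a − b‖`
  have hT2 : |(κ₁ va + κ₁ a' - κ₁ v - κ₁ a) - (κ₁ vb + κ₁ b' - κ₁ v - κ₁ b)| ≤
      8 * C * (X * Y * Z) * ‖a - b‖ := by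
    have e : (κ₁ va + κ₁ a' - κ₁ v - κ₁ a) - (κ₁ vb + κ₁ b' - κ₁ v - κ₁ b) =
        (κ₁ va - κ₁ vb) + (κ₁ a' - κ₁ b') - (κ₁ a - κ₁ b) := by ring
    rw [e]
    have hC2 : 0 ≤ C * (2 * (X * Y * Z)) := mul_nonneg hC (mul_nonneg zero_le_two hXYZ0)
    have f1 : |κ₁ va - κ₁ vb| ≤ C * (2 * (X * Y * Z)) * ‖a - b‖ :=
      (hκ₁L va vb).trans (mul_le_mul (mul_le_mul_of_nonneg_left w7 hC) hvab (norm_nonneg _) hC2)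
    have f2 : |κ₁ a' - κ₁ b'| ≤ C * (2 * (X * Y * Z)) * (2 * ‖a - b‖) :=
      (hκ₁L a' b').trans (mul_le_mul (mul_le_mul_of_nonneg_left w8 hC) ha'b' (norm_nonneg _) hC2)
    have f3 : |κ₁ a - κ₁ b| ≤ C * (2 * (X * Y * Z)) * ‖a - b‖ :=
      (hκ₁L a b).trans (mul_le_mul_of_nonneg_right (mul_le_mul_of_nonneg_left w9 hC) (norm_nonneg _))
    have e2 := abs_sub (κ₁ va - κ₁ vb + (κ₁ a' - κ₁ b')) (κ₁ a - κ₁ b)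
    have e3 := abs_add_le (κ₁ va - κ₁ vb) (κ₁ a' - κ₁ b')
    linarith only [e2, e3, f1, f2, f3]
  -- the two pieces
  have p1 : |ka * (κ₁ va + κ₂ a' - κ₁ v - κ₂ a) - ka * (κ₁ va + κ₁ a' - κ₁ v - κ₁ a)| ≤
      (X * Y) * (4 * C * (X * Y) * d) := by
    rw [← mul_sub, abs_mul, abs_of_nonneg hka0]
    exact mul_le_mul hkaXY hT1 (abs_nonneg _) hXY0
  have p2 : |ka * (κ₁ va + κ₁ a' - κ₁ v - κ₁ a) - kb * (κ₁ vb + κ₁ b' - κ₁ v - κ₁ b)| ≤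
      ‖a - b‖ * (4 * C * (X * Y)) + (X * Z) * (8 * C * (X * Y * Z) * ‖a - b‖) := by
    have e : ka * (κ₁ va + κ₁ a' - κ₁ v - κ₁ a) - kb * (κ₁ vb + κ₁ b' - κ₁ v - κ₁ b) =
        (ka - kb) * (κ₁ va + κ₁ a' - κ₁ v - κ₁ a) +
          kb * ((κ₁ va + κ₁ a' - κ₁ v - κ₁ a) - (κ₁ vb + κ₁ b' - κ₁ v - κ₁ b)) := by ring
    rw [e]
    refine (abs_add_le _ _).trans (add_le_add ?_ ?_)
    · rw [abs_mul]
      exact mul_le_mul hkab hBr0a (abs_nonneg _) (norm_nonneg _)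
    · rw [abs_mul, abs_of_nonneg hkb0]
      exact mul_le_mul hkbXZ hT2 (abs_nonneg _) hXZ0
  -- final polynomial bookkeeping
  have f1 : (X * Y) * (X * Y) ≤ (X * Y * Z) ^ 2 := by
    have h : X * Y ≤ X * Y * Z := le_mul_of_one_le_right hXY0 hZ1
    calc (X * Y) * (X * Y) ≤ (X * Y * Z) * (X * Y * Z) := mul_le_mul h h hXY0 hXYZ0
      _ = (X * Y * Z) ^ 2 := (sq _).symm
  have f2 : X * Y ≤ (X * Y * Z) ^ 2 :=
    (le_mul_of_one_le_right hXY0 hZ1).trans (le_self_pow₀ hXYZ1 two_ne_zero)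
  have f3 : (X * Z) * (X * Y * Z) ≤ (X * Y * Z) ^ 2 := by
    have h : X * Z ≤ X * Y * Z := mul_le_mul_of_nonneg_right w3 hZ0
    calc (X * Z) * (X * Y * Z) ≤ (X * Y * Z) * (X * Y * Z) := mul_le_mul_of_nonneg_right h hXYZ0
      _ = (X * Y * Z) ^ 2 := (sq _).symm
  have m1 := mul_le_mul_of_nonneg_left f1 (mul_nonneg (mul_nonneg zero_le_four hC) hd :
    (0 : ℝ) ≤ 4 * C * d)
  have m2 := mul_le_mul_of_nonneg_left f2 (mul_nonneg (mul_nonneg zero_le_four hC) (norm_nonneg (a - b)) :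
    (0 : ℝ) ≤ 4 * C * ‖a - b‖)
  have m3 := mul_le_mul_of_nonneg_left f3 (mul_nonneg (mul_nonneg (by norm_num) hC) (norm_nonneg (a - b)) :
    (0 : ℝ) ≤ 8 * C * ‖a - b‖)
  have n1 : 0 ≤ C * d * (X * Y * Z) ^ 2 := mul_nonneg (mul_nonneg hC hd) (sq_nonneg _)
  have n2 : 0 ≤ C * ‖a - b‖ * (X * Y * Z) ^ 2 := mul_nonneg (mul_nonneg hC (norm_nonneg _)) (sq_nonneg _)
  calc |ka * (κ₁ va + κ₂ a' - κ₁ v - κ₂ a) - kb * (κ₁ vb + κ₁ b' - κ₁ v - κ₁ b)|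
      ≤ |ka * (κ₁ va + κ₂ a' - κ₁ v - κ₂ a) - ka * (κ₁ va + κ₁ a' - κ₁ v - κ₁ a)| +
          |ka * (κ₁ va + κ₁ a' - κ₁ v - κ₁ a) - kb * (κ₁ vb + κ₁ b' - κ₁ v - κ₁ b)| :=
        abs_sub_le _ _ _
    _ ≤ (X * Y) * (4 * C * (X * Y) * d) +
          (‖a - b‖ * (4 * C * (X * Y)) + (X * Z) * (8 * C * (X * Y * Z) * ‖a - b‖)) :=
        add_le_add p1 p2
    _ ≤ 16 * C * (X * Y * Z) ^ 2 * (d + ‖a - b‖) := by linarith only [m1, m2, m3, n1, n2]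

/-- Growth of the two-function collision bracket: for `|κ₁|, |κ₂| ≤ C(1+|·|²)`,
`|((v−w)·ω)₊ [κ₁(v′) + κ₂(w′) − κ₁(v) − κ₂(w)]| ≤ 4 C ((1+|v|²)(1+|w|²))²`. [folklore] -/
theorem k2r_abs_bracket_le (ω : sphere (0 : V3) 1) {κ₁ κ₂ : V3 → ℝ} {C : ℝ}
    (hκ₁ : ∀ v, |κ₁ v| ≤ C * (1 + ‖v‖ ^ 2)) (hκ₂ : ∀ v, |κ₂ v| ≤ C * (1 + ‖v‖ ^ 2)) (v w : V3) :
    |hardSphereKernel (v, w) ω * (κ₁ (collide ω (v, w)).1 + κ₂ (collide ω (v, w)).2 - κ₁ v - κ₂ w)| ≤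
      4 * C * ((1 + ‖v‖ ^ 2) * (1 + ‖w‖ ^ 2)) ^ 2 := by
  have hC : 0 ≤ C := by
    have h := (abs_nonneg _).trans (hκ₁ 0)
    simpa using h
  have hk0 : 0 ≤ hardSphereKernel (v, w) ω := UkaiLanford.hardSphereKernel_nonneg' (v, w) ω
  have hk : hardSphereKernel (v, w) ω ≤ (1 + ‖v‖ ^ 2) * (1 + ‖w‖ ^ 2) := k2r_hardSphereKernel_le_sq ω v w
  have h1 : ‖(collide ω (v, w)).1‖ ^ 2 ≤ ‖v‖ ^ 2 + ‖w‖ ^ 2 := (norm_sq_collide_le ω (v, w)).1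
  have h2 : ‖(collide ω (v, w)).2‖ ^ 2 ≤ ‖v‖ ^ 2 + ‖w‖ ^ 2 := (norm_sq_collide_le ω (v, w)).2
  have hp : 0 ≤ ‖v‖ ^ 2 := sq_nonneg _
  have hq : 0 ≤ ‖w‖ ^ 2 := sq_nonneg _
  have hX0 : 0 ≤ (1 + ‖v‖ ^ 2) * (1 + ‖w‖ ^ 2) := by positivity
  have w1 : 1 + ‖(collide ω (v, w)).1‖ ^ 2 ≤ (1 + ‖v‖ ^ 2) * (1 + ‖w‖ ^ 2) := k2r_weight_aux₁ hp hq h1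
  have w2 : 1 + ‖(collide ω (v, w)).2‖ ^ 2 ≤ (1 + ‖v‖ ^ 2) * (1 + ‖w‖ ^ 2) := k2r_weight_aux₁ hp hq h2
  have w3 : 1 + ‖v‖ ^ 2 ≤ (1 + ‖v‖ ^ 2) * (1 + ‖w‖ ^ 2) :=
    le_mul_of_one_le_right (by positivity) (by linarith)
  have w4 : 1 + ‖w‖ ^ 2 ≤ (1 + ‖v‖ ^ 2) * (1 + ‖w‖ ^ 2) :=
    le_mul_of_one_le_left (by positivity) (by linarith)
  have g1 := (hκ₁ (collide ω (v, w)).1).trans (mul_le_mul_of_nonneg_left w1 hC)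
  have g2 := (hκ₂ (collide ω (v, w)).2).trans (mul_le_mul_of_nonneg_left w2 hC)
  have g3 := (hκ₁ v).trans (mul_le_mul_of_nonneg_left w3 hC)
  have g4 := (hκ₂ w).trans (mul_le_mul_of_nonneg_left w4 hC)
  have hBr : |κ₁ (collide ω (v, w)).1 + κ₂ (collide ω (v, w)).2 - κ₁ v - κ₂ w| ≤
      4 * C * ((1 + ‖v‖ ^ 2) * (1 + ‖w‖ ^ 2)) := by
    have e1 := abs_sub (κ₁ (collide ω (v, w)).1 + κ₂ (collide ω (v, w)).2 - κ₁ v) (κ₂ w)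
    have e2 := abs_sub (κ₁ (collide ω (v, w)).1 + κ₂ (collide ω (v, w)).2) (κ₁ v)
    have e3 := abs_add_le (κ₁ (collide ω (v, w)).1) (κ₂ (collide ω (v, w)).2)
    linarith only [e1, e2, e3, g1, g2, g3, g4]
  rw [abs_mul, abs_of_nonneg hk0]
  calc hardSphereKernel (v, w) ω * |κ₁ (collide ω (v, w)).1 + κ₂ (collide ω (v, w)).2 - κ₁ v - κ₂ w|
      ≤ ((1 + ‖v‖ ^ 2) * (1 + ‖w‖ ^ 2)) * (4 * C * ((1 + ‖v‖ ^ 2) * (1 + ‖w‖ ^ 2))) :=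
        mul_le_mul hk hBr (abs_nonneg _) hX0
    _ = 4 * C * ((1 + ‖v‖ ^ 2) * (1 + ‖w‖ ^ 2)) ^ 2 := by ring
/-! ## Registered sub-goal of stub `stub_correctorBalance` proved in this file -/

/-- **Registered sub-goal `stub_correctorBalance_pointwise`** (K2R line `birth`, stub B4, helper I): the
pointwise bracket estimate `k2r_bracket_pointwise`, as a closed statement. [folklore] -/
theorem stub_correctorBalance_pointwise :
    ∀ (ω : Metric.sphere (0 : EuclideanSpace ℝ (Fin 3)) 1) (κ₁ κ₂ : EuclideanSpace ℝ (Fin 3) → ℝ) (C d : ℝ),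
    0 ≤ d → (∀ v, |κ₁ v| ≤ C * (1 + ‖v‖ ^ 2)) →
    (∀ v v', |κ₁ v - κ₁ v'| ≤ C * (1 + ‖v‖ ^ 2 + ‖v'‖ ^ 2) * ‖v - v'‖) →
    (∀ v, |κ₁ v - κ₂ v| ≤ C * (1 + ‖v‖ ^ 2 + ‖v‖ ^ 2) * d) →
    ∀ (v a b : EuclideanSpace ℝ (Fin 3)),
    |Literature.MathematicalPhysics.KineticTheory.hardSphereKernel (v, a) ω *
        (κ₁ (Literature.MathematicalPhysics.KineticTheory.collide ω (v, a)).1 +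
          κ₂ (Literature.MathematicalPhysics.KineticTheory.collide ω (v, a)).2 - κ₁ v - κ₂ a) -
      Literature.MathematicalPhysics.KineticTheory.hardSphereKernel (v, b) ω *
        (κ₁ (Literature.MathematicalPhysics.KineticTheory.collide ω (v, b)).1 +
          κ₁ (Literature.MathematicalPhysics.KineticTheory.collide ω (v, b)).2 - κ₁ v - κ₁ b)| ≤
      16 * C * ((1 + ‖v‖ ^ 2) * (1 + ‖a‖ ^ 2) * (1 + ‖b‖ ^ 2)) ^ 2 * (d + ‖a - b‖) :=
  fun ω _ _ _ _ hd hκ₁ hκ₁L hκ₁₂ v a b => k2r_bracket_pointwise ω hd hκ₁ hκ₁L hκ₁₂ v a b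

end Summit.AtomisticToContinuum.HydrodynamicLimit.Theorems.EnskogAdjointDuality

end
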